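import Literature.MathematicalPhysics.QuantumLattice.GrassmannIntegralPartial
import HarnessLib

/-!
# Change of the coefficient ring in a Grassmann algebra (functoriality in the scalars)

Trunk **QLatticeAQFT**; companion of `GrassmannIntegral.lean` (`GrassmannAlgebra R ι = ⋀(ι → R)`,
monomial basis `grassmannBasis`, Berezin integral `berezin`) and `GrassmannIntegralSubstitution.lean`
(linear substitutions of the GENERATORS, `ExteriorAlgebra.map`). This file supplies the complementary
operation: a ring homomorphism `σ : R →+* R'` of the COEFFICIENTS induces the ring homomorphism

  `coeffMap σ : GrassmannAlgebra R ι →+* GrassmannAlgebra R' ι`,  `Σ_s a_s θ_s ↦ Σ_s σ(a_s) θ_s`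

(finitely many generators, linearly ordered, so that the monomials `θ_s`, `s : Finset ι`, form a basis).
In the applications the coefficients are functions of commuting ("bosonic") variables `φ` and `σ` is a
substitution `f ↦ f ∘ u` of those variables (rescaling, translation, relabelling of the field), which is
how "`F(φ', ψ')` for a form `F`" is made precise (e.g. Brydges–Imbrie–Slade 2009 §4; Bauerschmidt–
Brydges–Slade 2015 §4.1, the change of variables `φ ↦ (1+z₀)^{1/2}φ`).

Main results (all proved):
* `coeffMap σ` is a ring homomorphism with `coeffMap_grassmannBasis` (`θ_s ↦ θ_s`), `coeffMap_gen`,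
  `coeffMap_smul` (`σ`-semilinearity), `coeffMap_algebraMap`, `repr_coeffMap`
  (coordinates are mapped by `σ`), `coeffMap_id`, `coeffMap_comp`;
* **`berezin_coeffMap`**: `∫dθ (coeffMap σ x) = σ(∫dθ x)` — the Berezin integral (top coefficient)
  commutes with any change of coefficients;
* `coeffMap_grassmannExp`: `coeffMap σ (exp a) = exp (coeffMap σ a)` for nilpotent `a`;
* `coeffMap_map_smul_id`: `coeffMap` commutes with the rescaling `ExteriorAlgebra.map (c • id)` of the
  generators when `σ c = c'`.

The multiplicativity rests on the integrality of the structure constants of the monomial basis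
(`grassmannBasis_mul_grassmannBasis_of_disjoint` / `_of_not_disjoint`: `θ_uθ_s = ±θ_{u∪s}` or `0`).

## References
* F. A. Berezin, *The Method of Second Quantization* (1966), Ch. I §3 (Grassmann algebra with
  coefficients in a function ring; generating functionals `F(a*, a)`). [cite: BerezinSecondQuant1966, Ch. I §3]
* D. C. Brydges, J. Z. Imbrie, G. Slade, *Functional integral representations for self-avoiding walk*,
  Probab. Surveys 6 (2009), §4.1 (forms `Σ f(φ)dφ^I` with function coefficients). [cite: BrydgesImbrieSlade2009, §4.1]
-/

noncomputable section

namespace Literature.MathematicalPhysics.QuantumLattice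

section QLatticeAQFT

namespace GrassmannAlgebra

open scoped BigOperators

variable {R R' R'' : Type*} [CommRing R] [CommRing R'] [CommRing R''] {ι : Type*} [LinearOrder ι] [Fintype ι]

/-- The coefficientwise action of `σ : R →+* R'` on `Σ_s a_s θ_s`, as a bare function. [folklore] -/
def coeffMapFun (σ : R →+* R') (x : GrassmannAlgebra R ι) : GrassmannAlgebra R' ι :=
  ∑ s : Finset ι, σ ((grassmannBasis R ι).repr x s) • grassmannBasis R' ι s

/-- Coordinates of `coeffMapFun σ x` are the `σ`-images of those of `x`. [folklore] -/
theorem repr_coeffMapFun (σ : R →+* R') (x : GrassmannAlgebra R ι) (s : Finset ι) :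
    (grassmannBasis R' ι).repr (coeffMapFun σ x) s = σ ((grassmannBasis R ι).repr x s) := by
  rw [coeffMapFun, Module.Basis.repr_sum_self]

/-- `coeffMapFun` is additive. [folklore] -/
theorem coeffMapFun_add (σ : R →+* R') (x y : GrassmannAlgebra R ι) :
    coeffMapFun σ (x + y) = coeffMapFun σ x + coeffMapFun σ y := by
  simp only [coeffMapFun, map_add, Finsupp.add_apply, add_smul, Finset.sum_add_distrib]

/-- `coeffMapFun` is `σ`-semilinear. [folklore] -/
theorem coeffMapFun_smul (σ : R →+* R') (r : R) (x : GrassmannAlgebra R ι) :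
    coeffMapFun σ (r • x) = σ r • coeffMapFun σ x := by
  simp only [coeffMapFun, map_smul, Finsupp.smul_apply, smul_eq_mul, map_mul, mul_smul, Finset.smul_sum]

/-- `coeffMapFun` fixes the monomials. [folklore] -/
theorem coeffMapFun_grassmannBasis (σ : R →+* R') (s : Finset ι) :
    coeffMapFun σ (grassmannBasis R ι s) = grassmannBasis R' ι s := by
  classical
  rw [coeffMapFun, Module.Basis.repr_self, Finset.sum_eq_single s]
  · rw [Finsupp.single_eq_same, map_one, one_smul]
  · intro t _ hts
    rw [Finsupp.single_eq_of_ne hts, map_zero, zero_smul]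
  · intro h; exact absurd (Finset.mem_univ s) h

/-- `coeffMapFun (a • θ_s) = σ a • θ_s`. [folklore] -/
theorem coeffMapFun_smul_grassmannBasis (σ : R →+* R') (a : R) (s : Finset ι) :
    coeffMapFun σ (a • grassmannBasis R ι s) = σ a • grassmannBasis R' ι s := by
  rw [coeffMapFun_smul, coeffMapFun_grassmannBasis]

/-- `coeffMapFun 0 = 0`. [folklore] -/
theorem coeffMapFun_zero (σ : R →+* R') : coeffMapFun σ (0 : GrassmannAlgebra R ι) = 0 := by
  simp [coeffMapFun]

/-- `coeffMapFun 1 = 1` (`1 = θ_∅`). [folklore] -/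
theorem coeffMapFun_one (σ : R →+* R') : coeffMapFun σ (1 : GrassmannAlgebra R ι) = 1 := by
  rw [← grassmannBasis_empty R, coeffMapFun_grassmannBasis, grassmannBasis_empty]

/-- `coeffMapFun` as an additive monoid homomorphism. [folklore] -/
def coeffMapAddHom (σ : R →+* R') : GrassmannAlgebra R ι →+ GrassmannAlgebra R' ι where
  toFun := coeffMapFun σ
  map_zero' := coeffMapFun_zero σ
  map_add' := coeffMapFun_add σ

/-- Multiplicativity on scaled monomials: `coeffMapFun ((aθ_s)(bθ_t)) = (σa θ_s)(σb θ_t)` — the structure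
constants of the monomial basis are integers. [folklore] -/
theorem coeffMapFun_smul_basis_mul_smul_basis (σ : R →+* R') (a b : R) (s t : Finset ι) :
    coeffMapFun σ ((a • grassmannBasis R ι s) * (b • grassmannBasis R ι t)) =
      (σ a • grassmannBasis R' ι s) * (σ b • grassmannBasis R' ι t) := by
  rw [smul_mul_smul_comm, smul_mul_smul_comm]
  by_cases h : Disjoint s t
  · rw [grassmannBasis_mul_grassmannBasis_of_disjoint R h, grassmannBasis_mul_grassmannBasis_of_disjoint R' h,
      smul_smul, smul_smul, coeffMapFun_smul_grassmannBasis, map_mul, map_mul, map_intCast]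
  · rw [grassmannBasis_mul_grassmannBasis_of_not_disjoint R h,
      grassmannBasis_mul_grassmannBasis_of_not_disjoint R' h, smul_zero, smul_zero, coeffMapFun_zero]

/-- `coeffMapFun` is multiplicative. [folklore] -/
theorem coeffMapFun_mul (σ : R →+* R') (x y : GrassmannAlgebra R ι) :
    coeffMapFun σ (x * y) = coeffMapFun σ x * coeffMapFun σ y := by
  set bR := grassmannBasis R ι
  have hx : x = ∑ s, bR.repr x s • bR s := (bR.sum_repr x).symm
  have hy : y = ∑ t, bR.repr y t • bR t := (bR.sum_repr y).symm
  conv_lhs => rw [hx, hy, Finset.sum_mul_sum]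
  rw [show coeffMapFun σ (∑ s, ∑ t, bR.repr x s • bR s * bR.repr y t • bR t) =
      coeffMapAddHom σ (∑ s, ∑ t, bR.repr x s • bR s * bR.repr y t • bR t) from rfl, map_sum]
  simp_rw [map_sum]
  rw [show (fun s => ∑ t, coeffMapAddHom σ (bR.repr x s • bR s * bR.repr y t • bR t)) =
      fun s => ∑ t, (σ (bR.repr x s) • grassmannBasis R' ι s) * (σ (bR.repr y t) • grassmannBasis R' ι t) from
    funext fun s => Finset.sum_congr rfl fun t _ => coeffMapFun_smul_basis_mul_smul_basis σ _ _ s t,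
    ← Finset.sum_mul_sum]
  rfl

/-- **Change of coefficients along a ring homomorphism `σ : R →+* R'`**: the ring homomorphism
`Σ_s a_s θ_s ↦ Σ_s σ(a_s) θ_s` of Grassmann algebras (the generators are fixed, the coefficients are
mapped by `σ`). [folklore] -/
def coeffMap (σ : R →+* R') : GrassmannAlgebra R ι →+* GrassmannAlgebra R' ι where
  toFun := coeffMapFun σ
  map_one' := coeffMapFun_one σ
  map_mul' := coeffMapFun_mul σ
  map_zero' := coeffMapFun_zero σ
  map_add' := coeffMapFun_add σ

/-- Unfolding `coeffMap`. [folklore] -/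
theorem coeffMap_apply (σ : R →+* R') (x : GrassmannAlgebra R ι) :
    coeffMap σ x = ∑ s : Finset ι, σ ((grassmannBasis R ι).repr x s) • grassmannBasis R' ι s := rfl

/-- **Coordinates are mapped by `σ`.** [folklore] -/
theorem repr_coeffMap (σ : R →+* R') (x : GrassmannAlgebra R ι) (s : Finset ι) :
    (grassmannBasis R' ι).repr (coeffMap σ x) s = σ ((grassmannBasis R ι).repr x s) :=
  repr_coeffMapFun σ x s

/-- `coeffMap` is `σ`-semilinear. [folklore] -/
theorem coeffMap_smul (σ : R →+* R') (r : R) (x : GrassmannAlgebra R ι) :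
    coeffMap σ (r • x) = σ r • coeffMap σ x :=
  coeffMapFun_smul σ r x

/-- `coeffMap` fixes the monomials `θ_s`. [folklore] -/
theorem coeffMap_grassmannBasis (σ : R →+* R') (s : Finset ι) :
    coeffMap σ (grassmannBasis R ι s) = grassmannBasis R' ι s :=
  coeffMapFun_grassmannBasis σ s

/-- `coeffMap` fixes the generators `θ_i`. [folklore] -/
theorem coeffMap_gen (σ : R →+* R') (i : ι) : coeffMap σ (gen R i) = gen R' i := by
  rw [← grassmannBasis_singleton R, coeffMap_grassmannBasis, grassmannBasis_singleton]

/-- `coeffMap` on scalars: `coeffMap σ (algebraMap r) = algebraMap (σ r)`. [folklore] -/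
theorem coeffMap_algebraMap (σ : R →+* R') (r : R) :
    coeffMap σ (algebraMap R (GrassmannAlgebra R ι) r) = algebraMap R' (GrassmannAlgebra R' ι) (σ r) := by
  rw [Algebra.algebraMap_eq_smul_one, Algebra.algebraMap_eq_smul_one, coeffMap_smul, map_one]

/-- **The Berezin integral commutes with any change of coefficients**: `∫dθ (coeffMap σ x) = σ(∫dθ x)`
(the Berezin integral is the top coordinate). [folklore] -/
theorem berezin_coeffMap (σ : R →+* R') (x : GrassmannAlgebra R ι) :
    berezin R' ι (coeffMap σ x) = σ (berezin R ι x) := by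
  rw [berezin, berezin, Module.Basis.coord_apply, Module.Basis.coord_apply, repr_coeffMap]

/-- `coeffMap` commutes with the (nilpotent) exponential. [folklore] -/
theorem coeffMap_grassmannExp [Algebra ℚ R] [Algebra ℚ R'] (σ : R →+* R') {a : GrassmannAlgebra R ι}
    (ha : IsNilpotent a) : coeffMap σ (grassmannExp a) = grassmannExp (coeffMap σ a) :=
  ha.map_exp (coeffMap σ)

/-- The identity change of coefficients is the identity. [folklore] -/
theorem coeffMap_id (x : GrassmannAlgebra R ι) : coeffMap (RingHom.id R) x = x := by
  rw [coeffMap_apply]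
  exact (grassmannBasis R ι).sum_repr x

/-- Functoriality: `coeffMap τ ∘ coeffMap σ = coeffMap (τ ∘ σ)`. [folklore] -/
theorem coeffMap_comp (σ : R →+* R') (τ : R' →+* R'') (x : GrassmannAlgebra R ι) :
    coeffMap τ (coeffMap σ x) = coeffMap (τ.comp σ) x := by
  refine (Module.Basis.ext_elem_iff (grassmannBasis R'' ι)).2 fun s => ?_
  rw [repr_coeffMap, repr_coeffMap, repr_coeffMap, RingHom.comp_apply]

/-- **`coeffMap` commutes with a rescaling of the generators**: for `c : R`, `c' : R'` with `σ c = c'`,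
`coeffMap σ ∘ map (c • id) = map (c' • id) ∘ coeffMap σ` (both send `a θ_i ↦ σ(a) c' θ_i`). [folklore] -/
theorem coeffMap_map_smul_id (σ : R →+* R') {c : R} {c' : R'} (hc : σ c = c')
    (x : GrassmannAlgebra R ι) :
    coeffMap σ (ExteriorAlgebra.map (c • LinearMap.id : (ι → R) →ₗ[R] (ι → R)) x) =
      ExteriorAlgebra.map (c' • LinearMap.id : (ι → R') →ₗ[R'] (ι → R')) (coeffMap σ x) := by
  -- both sides are ring homomorphisms `⋀(ι → R) → ⋀(ι → R')` that are `σ`-semilinear; compare on `a • θ_s`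
  have hgen : ∀ i, ExteriorAlgebra.map (c • LinearMap.id : (ι → R) →ₗ[R] (ι → R)) (gen R i) = c • gen R i := by
    intro i
    rw [gen, ExteriorAlgebra.map_apply_ι, LinearMap.smul_apply, LinearMap.id_apply, map_smul]
  have hgen' : ∀ i, ExteriorAlgebra.map (c' • LinearMap.id : (ι → R') →ₗ[R'] (ι → R')) (gen R' i) = c' • gen R' i := by
    intro i
    rw [gen, ExteriorAlgebra.map_apply_ι, LinearMap.smul_apply, LinearMap.id_apply, map_smul]
  have hbasis : ∀ s : Finset ι,
      coeffMap σ (ExteriorAlgebra.map (c • LinearMap.id : (ι → R) →ₗ[R] (ι → R)) (grassmannBasis R ι s)) =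
        ExteriorAlgebra.map (c' • LinearMap.id : (ι → R') →ₗ[R'] (ι → R')) (grassmannBasis R' ι s) := by
    intro s
    induction s using Finset.induction_on_min with
    | empty => rw [grassmannBasis_empty, grassmannBasis_empty, map_one, map_one, map_one]
    | insert a u hmin ih =>
      rw [grassmannBasis_insert_of_forall_lt R hmin, grassmannBasis_insert_of_forall_lt R' hmin, map_mul, map_mul,
        map_mul, ih, hgen, hgen', coeffMap_smul, hc, coeffMap_gen]
  conv_lhs => rw [← (grassmannBasis R ι).sum_repr x]
  conv_rhs => rw [← (grassmannBasis R ι).sum_repr x]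
  simp only [map_sum, map_smul, coeffMap_smul, hbasis, coeffMap_grassmannBasis]

end GrassmannAlgebra

end QLatticeAQFT

end Literature.MathematicalPhysics.QuantumLattice
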